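import Summits.Ventures.HodgeRepro2.T6B1Bridge

/-!
# T6B1Embedding — B1 indexed by a complex embedding of the CM field (`τ = π(τ₁)`; Tier-6 sub-goal B1, proof lane)

The route's distinguished real place `τ` of `F⁺` is the place BELOW the distinguished complex embedding `τ₁ : F → ℂ`
of the face datum (TIER4 B1 (B1.d), B4 for `τ₁` vs `τ̄₁`): `τ = π(τ₁)`.  The host-side objects are embeddings
`F →+* ℂ` (the CM types of `T6Interface.FaceSetting` are sets of them), so Layer III wants `B1_main_cm` indexed by an
embedding rather than by a real place of `F⁺`.  This file supplies exactly that glue, with no new mathematics: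

* `placeBelow φ` — the infinite place of `F⁺ = maximalRealSubfield F` below `φ : F →+* ℂ` (`InfinitePlace.comap`);
  it is real (`F⁺` is totally real), and `placeBelow (conj ∘ φ) = placeBelow φ` — so the choice between `τ₁` and `τ̄₁`
  does not affect B1 (the statement is symmetric in the two, as recorded in route/T6-B1-t6-p4.md §5);
* `coe_realOf_placeBelow` / `realOf_placeBelow` — the real number `realOf` of `T6B1Carriers` at `placeBelow φ` is
  `φ x` (a real number for `x ∈ F⁺`);
* `B1_main_of_embedding` — `B1_main_cm` at `τ := placeBelow φ`.

§8(d): uses an L-value-free non-vanishing device: NO.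
-/

namespace Summit.Ventures.HodgeRepro2.T6
namespace B1Embedding

open NumberField B1Carriers B1Construct B1Fields B1Main B1Bridge
open scoped ComplexOrder

variable (F : Type*) [Field F] [NumberField F] [IsCMField F]

/-- `τ = π(τ₁)`: the infinite place of `F⁺ = maximalRealSubfield F` below the complex embedding `φ` of `F`. -/
noncomputable def placeBelow (φ : F →+* ℂ) : InfinitePlace (maximalRealSubfield F) :=
  (InfinitePlace.mk φ).comap (algebraMap (maximalRealSubfield F) F)

omit [NumberField F] [IsCMField F] in
/-- `placeBelow φ` is the place of the restricted embedding `φ|_{F⁺}`. -/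
theorem placeBelow_eq_mk (φ : F →+* ℂ) :
    placeBelow F φ = InfinitePlace.mk (φ.comp (algebraMap (maximalRealSubfield F) F)) :=
  InfinitePlace.comap_mk φ _

omit [IsCMField F] in
/-- The place below any complex embedding of `F` is real (`F⁺` is totally real). -/
theorem placeBelow_isReal (φ : F →+* ℂ) : (placeBelow F φ).IsReal :=
  IsTotallyReal.isReal _

omit [NumberField F] [IsCMField F] in
/-- `τ₁` and `τ̄₁ = conj ∘ τ₁` lie above the same real place of `F⁺`. -/
theorem placeBelow_conjugate (φ : F →+* ℂ) :
    placeBelow F (ComplexEmbedding.conjugate φ) = placeBelow F φ := by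
  unfold placeBelow
  rw [InfinitePlace.mk_conjugate_eq]

/-- An element of `F⁺` has a real image under every complex embedding of `F` (`φ ∘ c = conj ∘ φ` and `c` fixes
`F⁺`). -/
theorem embedding_im_eq_zero (φ : F →+* ℂ) (x : maximalRealSubfield F) : (φ (x : F)).im = 0 := by
  have h : φ (IsCMField.complexConj F (x : F)) = starRingEnd ℂ (φ (x : F)) :=
    embedding_comp_complexConj F φ (x : F)
  have hfix : IsCMField.complexConj F (x : F) = (x : F) := (IsCMField.complexConj F).commutes x
  rw [hfix] at h
  exact Complex.conj_eq_iff_im.1 h.symm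

/-- At `placeBelow φ`, the real number `realOf x` of `T6B1Carriers` is `φ x` (as a complex number). -/
theorem coe_realOf_placeBelow (φ : F →+* ℂ) (x : maximalRealSubfield F) :
    ((realOf (maximalRealSubfield F) (placeBelow_isReal F φ) x : ℝ) : ℂ) = φ (x : F) := by
  rw [coe_realOf]
  have hemb := InfinitePlace.embedding_mk_eq (φ.comp (algebraMap (maximalRealSubfield F) F))
  rw [← placeBelow_eq_mk] at hemb
  rcases hemb with h | h
  · rw [h]
    rfl
  · rw [h, ComplexEmbedding.conjugate_coe_eq]
    exact Complex.conj_eq_iff_im.2 (embedding_im_eq_zero F φ x)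

/-- At `placeBelow φ`, `realOf x = Re (φ x)`. -/
theorem realOf_placeBelow (φ : F →+* ℂ) (x : maximalRealSubfield F) :
    realOf (maximalRealSubfield F) (placeBelow_isReal F φ) x = (φ (x : F)).re := by
  rw [← coe_realOf_placeBelow F φ x, Complex.ofReal_re]

/-- **B1 indexed by the distinguished embedding `τ₁`.** For the CM field `F` and a complex embedding `φ = τ₁` of
`F`, assuming the three displayed theorems of O'Meara for `F⁺`: O'Meara's datum `θ`, the totally positive definite
incoherent `𝕍` of rank `3` and its `π(τ₁)`-nearby `W` of signature `(2, 1)` at `π(τ₁)` and positive definite at the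
other real places of `F⁺` — `B1_main_cm` at `τ := placeBelow φ`. -/
theorem B1_main_of_embedding (φ : F →+* ℂ)
    (h1 : Hyp.OMeara1963_65_15 (maximalRealSubfield F)) (h2 : Hyp.OMeara1963_71_18 (maximalRealSubfield F))
    (h3 : Hyp.OMeara1963_71_19 (maximalRealSubfield F)) :
    ∃ θ : maximalRealSubfield F, ¬ IsSquare θ ∧
      Nonempty (QuadraticAlgebra (maximalRealSubfield F) θ 0 ≃ₐ[maximalRealSubfield F] F) ∧
      (∀ (w : InfinitePlace (maximalRealSubfield F)) (hw : w.IsReal), realOf (maximalRealSubfield F) hw θ < 0) ∧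
      ∃ 𝕍 : AdelicHermitianSpace (maximalRealSubfield F) θ 3,
        IsTotallyPositiveDefinite (maximalRealSubfield F) 𝕍 ∧ IsIncoherentSpace (maximalRealSubfield F) 𝕍 ∧
        ∃ W : GlobalHermitianSpace (maximalRealSubfield F) θ 3,
          IsNearbyAt (maximalRealSubfield F) (placeBelow_isReal F φ) 𝕍 W ∧
          (∀ (w : InfinitePlace (maximalRealSubfield F)) (hw : w.IsReal), w ≠ placeBelow F φ →
            (globalGramAt (maximalRealSubfield F) W hw).PosDef) ∧
          HasSig (globalGramAt (maximalRealSubfield F) W (placeBelow_isReal F φ)) 2 1 :=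
  B1_main_cm F (placeBelow_isReal F φ) h1 h2 h3

end B1Embedding
end Summit.Ventures.HodgeRepro2.T6
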